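import Summits.Ventures.PercRepro.C041TriDomExcessMinor

/-!
# ROW C-041 — THE EQUALITY CASE OF THE EXCESS, VII: THE STAR MINOR AND THE THEOREMS `e ≥ 1`
(p6, gen 43; §53 ADDENDUM 2)

On part VI (`C041TriDomExcessMinor`: three-free statuses, `TriMinor`, its patterns).  THE STAR MINOR `StarMinor`
(a centre `c` whose double-component is joined by `f₁, f₂, f₃` to the pairwise distinct double-components of
`a₁, u, u'`): the connectivity between two marks is the conjunction of their two spokes (`reach_starMinor_iff`), the
red pattern is `starPat (p, q, r) = (p∧q, p∧r, q∧r)` and the blue one `starPat` of the negations (`rsig_starMinor`,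
`bsig_starMinor`); `starG ≥ 0` with `1` at all-red and all-blue (`decide`).  THE COUNT for any pattern function with
these properties (`esym_ge_two_mul_fiber`), THE DELETION–CONTRACTION CHAIN (`esym_setStatus_le`: every non-free
edge of the minor is absent or double and costs a factor `≤ 2`), and the THEOREMS: a host admitting a triangle minor
or a star minor on its marks has excess `≥ 1` (`excess_ge_one_of_triMinor`, `excess_ge_one_of_starMinor`) — the
converse of THEOREM (SEPARABLE ⟹ `e = 0`) on every host with a cycle or a tripod through its marks, the
Menger-type existence of the minor staying paper.
-/

namespace PercRepro

namespace ZoneZ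

namespace MultiExit

open ZoneData Finset

variable {V₁ E₁ U₁ U₂ : Type} (Z₁ : ZoneData V₁ E₁ U₁ U₂) (u u' a₁ : V₁)

/-! ## The star minor -/

/-- `st` is a STAR MINOR on the marks: a centre `c` in a fourth double-component, and three free spokes
`f₁ : c–a₁`, `f₂ : c–u`, `f₃ : c–u'` between the components. -/
structure StarMinor (st : E₁ → EStat) (c : V₁) (f₁ f₂ f₃ : E₁) : Prop where
  three : ThreeFree st f₁ f₂ f₃
  nca : ¬ DConn Z₁ st c a₁
  ncu : ¬ DConn Z₁ st c u
  ncu' : ¬ DConn Z₁ st c u'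
  nau : ¬ DConn Z₁ st a₁ u
  nau' : ¬ DConn Z₁ st a₁ u'
  nuu' : ¬ DConn Z₁ st u u'
  j1 : ∃ x y, Z₁.Joins f₁ x y ∧ DConn Z₁ st c x ∧ DConn Z₁ st a₁ y
  j2 : ∃ x y, Z₁.Joins f₂ x y ∧ DConn Z₁ st c x ∧ DConn Z₁ st u y
  j3 : ∃ x y, Z₁.Joins f₃ x y ∧ DConn Z₁ st c x ∧ DConn Z₁ st u' y

/-- Connectivity from `a` to `b` in a star minor with centre `z` and spokes `e₁ : z–a`, `e₂ : z–b`, `e₃ : z–d`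
through the double edges and the spokes satisfying `P`: `P e₁ ∧ P e₂`. -/
theorem reach_starMinor_iff {st : E₁ → EStat} {z a b d : V₁} {e₁ e₂ e₃ : E₁}
    (hza : ¬ DConn Z₁ st z a) (hzb : ¬ DConn Z₁ st z b) (hzd : ¬ DConn Z₁ st z d)
    (hab : ¬ DConn Z₁ st a b) (had : ¬ DConn Z₁ st a d) (hbd : ¬ DConn Z₁ st b d)
    (j1 : ∃ x y, Z₁.Joins e₁ x y ∧ DConn Z₁ st z x ∧ DConn Z₁ st a y)
    (j2 : ∃ x y, Z₁.Joins e₂ x y ∧ DConn Z₁ st z x ∧ DConn Z₁ st b y)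
    (j3 : ∃ x y, Z₁.Joins e₃ x y ∧ DConn Z₁ st z x ∧ DConn Z₁ st d y) (P : E₁ → Prop) :
    Relation.ReflTransGen (AdjCol Z₁ fun e => dblE st e ∨ ((e = e₁ ∨ e = e₂ ∨ e = e₃) ∧ P e)) a b ↔
      (P e₁ ∧ P e₂) := by
  obtain ⟨x₁, y₁, hj1, hx1, hy1⟩ := j1
  obtain ⟨x₂, y₂, hj2, hx2, hy2⟩ := j2
  obtain ⟨x₃, y₃, hj3, hx3, hy3⟩ := j3
  constructor
  · intro h
    have key : ∀ v, Relation.ReflTransGen (AdjCol Z₁ fun e => dblE st e ∨ ((e = e₁ ∨ e = e₂ ∨ e = e₃) ∧ P e)) a v →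
        DConn Z₁ st a v ∨ (DConn Z₁ st z v ∧ P e₁) ∨ (DConn Z₁ st b v ∧ P e₁ ∧ P e₂) ∨
          (DConn Z₁ st d v ∧ P e₁ ∧ P e₃) := by
      intro v hv
      induction hv with
      | refl => exact Or.inl (DConn_refl Z₁ st a)
      | @tail w v _ hwv ih =>
        obtain ⟨e, hj, he⟩ := hwv
        rcases he with hd | ⟨he, hP⟩
        · have hwv' := DConn_of_dblE Z₁ hd hj
          rcases ih with h | ⟨h, hh⟩ | ⟨h, hh⟩ | ⟨h, hh⟩
          · exact Or.inl (DConn_trans Z₁ h hwv')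
          · exact Or.inr (Or.inl ⟨DConn_trans Z₁ h hwv', hh⟩)
          · exact Or.inr (Or.inr (Or.inl ⟨DConn_trans Z₁ h hwv', hh⟩))
          · exact Or.inr (Or.inr (Or.inr ⟨DConn_trans Z₁ h hwv', hh⟩))
        · rcases he with rfl | rfl | rfl
          · -- the spoke `e₁ : z–a`
            rcases joins_unique hj1 hj with ⟨hw, hv⟩ | ⟨hw, hv⟩
            · subst hv; exact Or.inl hy1
            · subst hv; exact Or.inr (Or.inl ⟨hx1, hP⟩)
          · -- the spoke `e₂ : z–b`
            rcases joins_unique hj2 hj with ⟨hw, hv⟩ | ⟨hw, hv⟩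
            · -- from the centre to `b`
              subst hw; subst hv
              rcases ih with h | ⟨_, hp⟩ | ⟨h, _⟩ | ⟨h, _⟩
              · exact absurd (DConn_symm Z₁ (DConn_trans Z₁ h (DConn_symm Z₁ hx2))) hza
              · exact Or.inr (Or.inr (Or.inl ⟨hy2, hp, hP⟩))
              · exact absurd (DConn_symm Z₁ (DConn_trans Z₁ h (DConn_symm Z₁ hx2))) hzb
              · exact absurd (DConn_symm Z₁ (DConn_trans Z₁ h (DConn_symm Z₁ hx2))) hzd
            · -- from `b` to the centre
              subst hw; subst hv
              rcases ih with h | ⟨h, _⟩ | ⟨_, hp, _⟩ | ⟨h, _⟩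
              · exact absurd (DConn_trans Z₁ h (DConn_symm Z₁ hy2)) hab
              · exact absurd (DConn_trans Z₁ h (DConn_symm Z₁ hy2)) hzb
              · exact Or.inr (Or.inl ⟨hx2, hp⟩)
              · exact absurd (DConn_symm Z₁ (DConn_trans Z₁ h (DConn_symm Z₁ hy2))) hbd
          · -- the spoke `e₃ : z–d`
            rcases joins_unique hj3 hj with ⟨hw, hv⟩ | ⟨hw, hv⟩
            · subst hw; subst hv
              rcases ih with h | ⟨_, hp⟩ | ⟨h, _⟩ | ⟨h, _⟩
              · exact absurd (DConn_symm Z₁ (DConn_trans Z₁ h (DConn_symm Z₁ hx3))) hza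
              · exact Or.inr (Or.inr (Or.inr ⟨hy3, hp, hP⟩))
              · exact absurd (DConn_symm Z₁ (DConn_trans Z₁ h (DConn_symm Z₁ hx3))) hzb
              · exact absurd (DConn_symm Z₁ (DConn_trans Z₁ h (DConn_symm Z₁ hx3))) hzd
            · subst hw; subst hv
              rcases ih with h | ⟨h, _⟩ | ⟨h, _⟩ | ⟨_, hp, _⟩
              · exact absurd (DConn_trans Z₁ h (DConn_symm Z₁ hy3)) had
              · exact absurd (DConn_trans Z₁ h (DConn_symm Z₁ hy3)) hzd
              · exact absurd (DConn_trans Z₁ h (DConn_symm Z₁ hy3)) hbd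
              · exact Or.inr (Or.inl ⟨hx3, hp⟩)
    rcases key b h with hb | ⟨hb, _⟩ | ⟨_, hb⟩ | ⟨hb, _⟩
    · exact absurd hb hab
    · exact absurd hb hzb
    · exact hb
    · exact absurd (DConn_symm Z₁ hb) hbd
  · have hdbl : ∀ {v w : V₁}, DConn Z₁ st v w →
        Relation.ReflTransGen (AdjCol Z₁ fun e => dblE st e ∨ ((e = e₁ ∨ e = e₂ ∨ e = e₃) ∧ P e)) v w := by
      intro v w hvw
      unfold DConn at hvw
      rw [mem_reach_singleton] at hvw
      induction hvw with
      | refl => exact Relation.ReflTransGen.refl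
      | tail _ hxy ih =>
        obtain ⟨e, hj, hd⟩ := hxy
        exact ih.tail ⟨e, hj, Or.inl hd⟩
    rintro ⟨hp, hq⟩
    refine (((hdbl hy1).tail ⟨e₁, Joins_symm Z₁ hj1, Or.inr ⟨Or.inl rfl, hp⟩⟩).trans
      (hdbl (DConn_trans Z₁ (DConn_symm Z₁ hx1) hx2))).trans ?_
    exact (Relation.ReflTransGen.single ⟨e₂, hj2, Or.inr ⟨Or.inr (Or.inl rfl), hq⟩⟩).trans
      (hdbl (DConn_symm Z₁ hy2))

/-- The adjacency of a three-free status through the red edges. -/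
theorem RAdjS_threeFree {st : E₁ → EStat} {f₁ f₂ f₃ : E₁} (h : ThreeFree st f₁ f₂ f₃) (ω : E₁ → Bool) :
    RAdjS Z₁ st ω = AdjCol Z₁ fun e => dblE st e ∨ ((e = f₁ ∨ e = f₂ ∨ e = f₃) ∧ ω e = true) := by
  funext x y
  exact propext (exists_congr fun e => and_congr_right fun _ => redE_threeFree h ω e)

/-- The adjacency of a three-free status through the blue edges. -/
theorem BAdjS_threeFree {st : E₁ → EStat} {f₁ f₂ f₃ : E₁} (h : ThreeFree st f₁ f₂ f₃) (ω : E₁ → Bool) :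
    BAdjS Z₁ st ω = AdjCol Z₁ fun e => dblE st e ∨ ((e = f₁ ∨ e = f₂ ∨ e = f₃) ∧ ω e = false) := by
  funext x y
  exact propext (exists_congr fun e => and_congr_right fun _ => blueE_threeFree h ω e)

/-- The star's pattern as a function of the three spoke colours. -/
def starPat (p q r : Bool) : P3 := (p && q, p && r, q && r)

/-- The permuted edge triple of a three-free status is three-free. -/
theorem ThreeFree.perm132 {st : E₁ → EStat} {f₁ f₂ f₃ : E₁} (h : ThreeFree st f₁ f₂ f₃) :
    ThreeFree st f₁ f₃ f₂ :=
  ⟨h.1, h.2.2.1, h.2.1, fun e h1 h3 h2 => h.2.2.2 e h1 h2 h3⟩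

/-- The permuted edge triple of a three-free status is three-free. -/
theorem ThreeFree.perm231 {st : E₁ → EStat} {f₁ f₂ f₃ : E₁} (h : ThreeFree st f₁ f₂ f₃) :
    ThreeFree st f₂ f₃ f₁ :=
  ⟨h.2.1, h.2.2.1, h.1, fun e h2 h3 h1 => h.2.2.2 e h1 h2 h3⟩

open Classical in
/-- THE RED PATTERN OF A STAR MINOR. -/
theorem rsig_starMinor {st : E₁ → EStat} {c : V₁} {f₁ f₂ f₃ : E₁} (h : StarMinor Z₁ u u' a₁ st c f₁ f₂ f₃)
    (ω : E₁ → Bool) : rsig Z₁ u u' a₁ st ω = starPat (ω f₁) (ω f₂) (ω f₃) := by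
  have e1 : RdS Z₁ st ω a₁ u ↔ (ω f₁ = true ∧ ω f₂ = true) := by
    unfold RdS; rw [mem_reach_singleton, RAdjS_threeFree Z₁ h.three]
    exact reach_starMinor_iff Z₁ h.nca h.ncu h.ncu' h.nau h.nau' h.nuu' h.j1 h.j2 h.j3 _
  have e2 : RdS Z₁ st ω a₁ u' ↔ (ω f₁ = true ∧ ω f₃ = true) := by
    unfold RdS; rw [mem_reach_singleton, RAdjS_threeFree Z₁ h.three]
    have := reach_starMinor_iff Z₁ h.nca h.ncu' h.ncu h.nau' h.nau (fun hc => h.nuu' (DConn_symm Z₁ hc))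
      h.j1 h.j3 h.j2 (fun e => ω e = true)
    rwa [show (fun e => dblE st e ∨ ((e = f₁ ∨ e = f₃ ∨ e = f₂) ∧ ω e = true)) =
      (fun e => dblE st e ∨ ((e = f₁ ∨ e = f₂ ∨ e = f₃) ∧ ω e = true)) by
        funext e; exact propext (by tauto)] at this
  have e3 : RdS Z₁ st ω u u' ↔ (ω f₂ = true ∧ ω f₃ = true) := by
    unfold RdS; rw [mem_reach_singleton, RAdjS_threeFree Z₁ h.three]
    have := reach_starMinor_iff Z₁ h.ncu h.ncu' h.nca h.nuu' (fun hc => h.nau (DConn_symm Z₁ hc))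
      (fun hc => h.nau' (DConn_symm Z₁ hc)) h.j2 h.j3 h.j1 (fun e => ω e = true)
    rwa [show (fun e => dblE st e ∨ ((e = f₂ ∨ e = f₃ ∨ e = f₁) ∧ ω e = true)) =
      (fun e => dblE st e ∨ ((e = f₁ ∨ e = f₂ ∨ e = f₃) ∧ ω e = true)) by
        funext e; exact propext (by tauto)] at this
  unfold rsig starPat
  refine Prod.ext (decide_eq_of_iff ?_) (Prod.ext (decide_eq_of_iff ?_) (decide_eq_of_iff ?_))
  · rw [e1]; simp
  · rw [e2]; simp
  · rw [e3]; simp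

open Classical in
/-- THE BLUE PATTERN OF A STAR MINOR. -/
theorem bsig_starMinor {st : E₁ → EStat} {c : V₁} {f₁ f₂ f₃ : E₁} (h : StarMinor Z₁ u u' a₁ st c f₁ f₂ f₃)
    (ω : E₁ → Bool) : bsig Z₁ u u' a₁ st ω = starPat (!ω f₁) (!ω f₂) (!ω f₃) := by
  have e1 : MgS Z₁ st ω a₁ u ↔ (ω f₁ = false ∧ ω f₂ = false) := by
    unfold MgS; rw [mem_reach_singleton, BAdjS_threeFree Z₁ h.three]
    exact reach_starMinor_iff Z₁ h.nca h.ncu h.ncu' h.nau h.nau' h.nuu' h.j1 h.j2 h.j3 _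
  have e2 : MgS Z₁ st ω a₁ u' ↔ (ω f₁ = false ∧ ω f₃ = false) := by
    unfold MgS; rw [mem_reach_singleton, BAdjS_threeFree Z₁ h.three]
    have := reach_starMinor_iff Z₁ h.nca h.ncu' h.ncu h.nau' h.nau (fun hc => h.nuu' (DConn_symm Z₁ hc))
      h.j1 h.j3 h.j2 (fun e => ω e = false)
    rwa [show (fun e => dblE st e ∨ ((e = f₁ ∨ e = f₃ ∨ e = f₂) ∧ ω e = false)) =
      (fun e => dblE st e ∨ ((e = f₁ ∨ e = f₂ ∨ e = f₃) ∧ ω e = false)) by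
        funext e; exact propext (by tauto)] at this
  have e3 : MgS Z₁ st ω u u' ↔ (ω f₂ = false ∧ ω f₃ = false) := by
    unfold MgS; rw [mem_reach_singleton, BAdjS_threeFree Z₁ h.three]
    have := reach_starMinor_iff Z₁ h.ncu h.ncu' h.nca h.nuu' (fun hc => h.nau (DConn_symm Z₁ hc))
      (fun hc => h.nau' (DConn_symm Z₁ hc)) h.j2 h.j3 h.j1 (fun e => ω e = false)
    rwa [show (fun e => dblE st e ∨ ((e = f₂ ∨ e = f₃ ∨ e = f₁) ∧ ω e = false)) =
      (fun e => dblE st e ∨ ((e = f₁ ∨ e = f₂ ∨ e = f₃) ∧ ω e = false)) by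
        funext e; exact propext (by tauto)] at this
  unfold bsig starPat
  refine Prod.ext (decide_eq_of_iff ?_) (Prod.ext (decide_eq_of_iff ?_) (decide_eq_of_iff ?_))
  · rw [e1]; simp
  · rw [e2]; simp
  · rw [e3]; simp

/-- The contribution of a colouring of the star. -/
def starG (b : Bool × Bool × Bool) : ℤ := Fsym (starPat b.1 b.2.1 b.2.2) (starPat (!b.1) (!b.2.1) (!b.2.2))

/-- The star never shows a crossed pair. -/
theorem starG_nonneg : ∀ b : Bool × Bool × Bool, 0 ≤ starG b := by decide

/-- All red: `(⊤, ⊥)`. -/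
theorem starG_ttt : starG (true, true, true) = 1 := by decide

/-- All blue: `(⊥, ⊤)`. -/
theorem starG_fff : starG (false, false, false) = 1 := by decide

end MultiExit

end ZoneZ

end PercRepro
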